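import Mathlib
import Literature.NumberTheory.Sieve.Maynard2016OmegaSmall
import HarnessLib

/-!
# Maynard 2016: the `p ≤ w` part of `𝔖_{m,q}` does not depend on `q`

Topic `Literature/NumberTheory/Sieve`. J. Maynard, *Large gaps between primes*, Ann. of Math. (2)
183 (2016), 915–933 = arXiv:1408.5110, §5 display (5.2) and §6 (display (6.6) and the proofs of
Lemmas 6–7, where the sums are first split "into residue classes modulo `P_w`"). Writing
`𝔖_{m,q} = ∏_{p ≤ w} (…) · ∏_{w < p ≤ y} (…)`, the factor over the primes `p ≤ w` (all of which
divide `P_w`) equals `∏_{p ≤ w} (1 − ω_m(p)/p)(1 − 1/p)^{−2k}` with `ω_m(p) = 1` if `p ∣ m` and `= 2`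
if `p ∤ m` (tree: `omegaMQ_eq_of_dvd_Pw`); in particular it is independent of `q`, and
`(1 − ω_m(p)/p)(1 − 1/p)^{−1} = (p − 2)/(p − 1)` for `p ∤ m` (`= 1` for `p ∣ m`), the local factor of
the singular series `𝔖_m` of Lemma 3.

PROVED here (no named facts): `prod_small_eq` (the `p ≤ w` product with `ω_{m,q}` replaced by `ω_m`), `singSeriesMQ_split`
(`𝔖_{m,q} = (∏_{p ≤ w}) · (∏_{w < p ≤ y})` when `⌊w⌋ ≤ ⌊y⌋`), `local_factor_eq`
(`(1 − ω_m(p)/p)(1 − 1/p)^{−1} = if p ∣ m then 1 else (p − 2)/(p − 1)`) and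
`eventually_floor_wFun_le_floor_y`.

## References

* J. Maynard, *Large gaps between primes*, Ann. of Math. (2) 183 (2016), 915–933; arXiv:1408.5110,
  §5 (5.2), §6 (6.6). [Maynard2016LargeGaps]
-/

open Filter Finset
open scoped Topology

namespace Literature.NumberTheory.Sieve

namespace Maynard2016

/-- **The `p ≤ w` part of `𝔖_{m,q}` is independent of `q`** (`k ≥ 1`): for primes `p ≤ ⌊w⌋`,
`ω_{m,q}(p) = ω_m(p) := (if p ∣ m then 1 else 2)`. [cite: Maynard2016LargeGaps, §6 display (6.6)] -/
theorem prod_small_eq {k : ℕ} (hk : 0 < k) (x m q : ℕ) :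
    ∏ p ∈ (Finset.Iic ⌊wFun x⌋₊).filter Nat.Prime,
        (1 - (omegaMQ k x m q p : ℝ) / p) * ((1 - 1 / (p : ℝ)) ^ (2 * k))⁻¹ =
      ∏ p ∈ (Finset.Iic ⌊wFun x⌋₊).filter Nat.Prime,
        (1 - ((if p ∣ m then 1 else 2 : ℕ) : ℝ) / p) * ((1 - 1 / (p : ℝ)) ^ (2 * k))⁻¹ := by
  refine Finset.prod_congr rfl fun p hp => ?_
  rw [Finset.mem_filter, Finset.mem_Iic] at hp
  have hpw : p ∣ Pw x := by
    unfold Pw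
    exact hp.2.dvd_primorial_iff.2 hp.1
  rw [omegaMQ_eq_of_dvd_Pw hk x m q hp.2 hpw]

/-- **Splitting `𝔖_{m,q}` at `w`:** if `⌊w⌋ ≤ ⌊y⌋` then
`𝔖_{m,q} = ∏_{p ≤ ⌊w⌋} (…) · ∏_{⌊w⌋ < p ≤ ⌊y⌋} (…)`. [cite: Maynard2016LargeGaps, §5 display (5.2)] -/
theorem singSeriesMQ_split (k : ℕ) (ε : ℝ) (x m q : ℕ) (hwy : ⌊wFun x⌋₊ ≤ ⌊y ε x⌋₊) :
    singSeriesMQ k ε x m q =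
      (∏ p ∈ (Finset.Iic ⌊wFun x⌋₊).filter Nat.Prime,
          (1 - (omegaMQ k x m q p : ℝ) / p) * ((1 - 1 / (p : ℝ)) ^ (2 * k))⁻¹) *
        ∏ p ∈ (Finset.Ioc ⌊wFun x⌋₊ ⌊y ε x⌋₊).filter Nat.Prime,
          (1 - (omegaMQ k x m q p : ℝ) / p) * ((1 - 1 / (p : ℝ)) ^ (2 * k))⁻¹ := by
  unfold singSeriesMQ
  have hsplit : (Finset.Iic ⌊y ε x⌋₊).filter Nat.Prime =
      (Finset.Iic ⌊wFun x⌋₊).filter Nat.Prime ∪ (Finset.Ioc ⌊wFun x⌋₊ ⌊y ε x⌋₊).filter Nat.Prime := by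
    ext p
    simp only [Finset.mem_filter, Finset.mem_union, Finset.mem_Iic, Finset.mem_Ioc]
    constructor
    · rintro ⟨h1, h2⟩
      rcases le_or_gt p ⌊wFun x⌋₊ with h | h
      · exact Or.inl ⟨h, h2⟩
      · exact Or.inr ⟨⟨h, h1⟩, h2⟩
    · rintro (⟨h1, h2⟩ | ⟨⟨h1, h1'⟩, h2⟩)
      · exact ⟨h1.trans hwy, h2⟩
      · exact ⟨h1', h2⟩
  have hdisj : Disjoint ((Finset.Iic ⌊wFun x⌋₊).filter Nat.Prime)
      ((Finset.Ioc ⌊wFun x⌋₊ ⌊y ε x⌋₊).filter Nat.Prime) := by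
    rw [Finset.disjoint_left]
    intro p h1 h2
    rw [Finset.mem_filter, Finset.mem_Iic] at h1
    rw [Finset.mem_filter, Finset.mem_Ioc] at h2
    omega
  rw [hsplit, Finset.prod_union hdisj]

/-- The local factor at a prime `p ∣ P_w`:
`(1 − ω_m(p)/p)(1 − 1/p)^{−1} = 1` if `p ∣ m` and `= (p − 2)/(p − 1)` if `p ∤ m` — the local
factor of `𝔖_m` in Lemma 3. [cite: Maynard2016LargeGaps, Lemma 3 (definition of 𝔖_m) and §6 (6.6)] -/
theorem local_factor_eq {p : ℕ} (hp : p.Prime) (m : ℕ) :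
    (1 - ((if p ∣ m then 1 else 2 : ℕ) : ℝ) / p) * (1 - 1 / (p : ℝ))⁻¹ =
      if p ∣ m then 1 else ((p : ℝ) - 2) / ((p : ℝ) - 1) := by
  have hp1 : (1 : ℝ) < p := by exact_mod_cast hp.one_lt
  have hp0 : (p : ℝ) ≠ 0 := Nat.cast_ne_zero.2 hp.ne_zero
  have hp1' : (p : ℝ) - 1 ≠ 0 := ne_of_gt (by linarith)
  have hsub : 1 - 1 / (p : ℝ) = ((p : ℝ) - 1) / p := by field_simp
  have h1p : 1 - 1 / (p : ℝ) ≠ 0 := by rw [hsub]; exact div_ne_zero hp1' hp0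
  split_ifs with h
  · push_cast
    exact mul_inv_cancel₀ h1p
  · push_cast
    have h2 : 1 - 2 / (p : ℝ) = ((p : ℝ) - 2) / p := by field_simp
    rw [h2, hsub, inv_div, div_mul_div_comm, mul_comm ((p : ℝ) - 2) (p : ℝ), ← div_mul_div_comm,
      div_self hp0, one_mul]

/-- `⌊w⌋ ≤ ⌊y⌋` for all large `x` (`ε ≤ 1/2`; from `w + 1 ≤ y`). [cite: Maynard2016LargeGaps, §4 (choice of w)] -/
theorem eventually_floor_wFun_le_floor_y {ε : ℝ} (hε : ε ≤ 1 / 2) :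
    ∀ᶠ x : ℕ in atTop, ⌊wFun x⌋₊ ≤ ⌊y ε x⌋₊ := by
  filter_upwards [eventually_wTrick hε] with x hx
  exact Nat.floor_mono (by linarith [hx.2.2.1])

end Maynard2016

end Literature.NumberTheory.Sieve
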